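import Mathlib.RingTheory.Ideal.Span
import Mathlib.RingTheory.Ideal.Operations
import Mathlib.Tactic.LinearCombination
import Mathlib.Tactic.Ring
import HarnessLib

/-!
# Kloosterman's degeneration of a complete intersection of multidegree (2,2,1,…,1) to the difference of two `k`-planes in a quartic

R. Kloosterman, *On a conjecture on Hodge loci of linear combinations of linear subvarieties*,
Rend. Circ. Mat. Palermo (2) 74 (2025), arXiv:2312.12363, §6, Proposition 6.1 and its proof
[cite: Kloosterman2025, Prop. 6.1].

**The printed statement (Prop. 6.1).** "Let `k ≥ 1` be an integer. Let `X ⊂ ℙ^{2k+1}` be a hypersurface of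
degree 4 containing two `k`-planes intersecting in dimension `k − 2`. Then there exists a flat family
`(X_t, Y_t)` where `X_t ⊂ ℙ^{2k+1}` is an irreducible quartic hypersurface, `Y_t ⊂ X_t` is subscheme of degree 4
and of pure dimension `k`, such that `Y_t` is irreducible for general `t`, `X_0 = X` and
`[Y_0]_prim = [Π₁]_prim − [Π₂]_prim`." With `Π₁ = V(x₀,x₁,x_{k+3},…,x_{2k+1})`, `Π₂ = V(x₂,x₃,x_{k+3},…,x_{2k+1})`
the proof writes the equation of ANY such `X` in the normal form
`f₀ = x₀x₂Q₀₂ + x₁x₂Q₁₂ + x₀x₃Q₀₃ + x₁x₃Q₁₃ + Σ_{i ≥ k+3} xᵢPᵢ`, puts `f_t := f₀ + t(Q₁₃Q₀₂ − Q₁₂Q₀₃)` and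
`I^{(t)} := ⟨x₀x₂ + tQ₁₃, x₁x₂ − tQ₀₃, x_{k+3}, …, x_{2k+1}⟩` (a complete intersection of multidegree
`(2,2,1,…,1)` for `t ≠ 0`), and rests on two identities, each introduced by "note that" / "one easily checks":

* (6.1.a) `f_t = (x₀x₂ + tQ₁₃)(Q₀₂ + x₁x₃/t) + (x₁x₂ − tQ₀₃)(Q₁₂ − x₀x₃/t)`, hence `f_t ∈ I^{(t)}`, i.e.
  `X_t ⊃ Y_t := V(I^{(t)})` for `t ≠ 0`;
* (6.1.b) `(1/t)·(x₁(x₀x₂ + tQ₁₃) − x₀(x₁x₂ − tQ₀₃)) = x₁Q₁₃ + x₀Q₀₃ ∈ I^{(t)}`, the element whose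
  specialisation, together with `x₀x₂, x₁x₂`, generates the flat limit
  `I^{(0)} = ⟨x₀x₂, x₁x₂, x₁Q₁₃ + x₀Q₀₃, x_{k+3}, …⟩` with
  `V(I^{(0)}) = V(x₂, x₁Q₁₃ + x₀Q₀₃, …) ∪ V(x₀, x₁, …) ⊇ Π₁`.

This file PROVES (6.1.a) and (6.1.b) as identities in an arbitrary commutative ring (the variables, the
quadrics `Q_{ij}` and the parameter `t` are arbitrary ring elements, `t` invertible; the linear part
`Σ xᵢPᵢ` is any element of any ideal `J`, standing for `⟨x_{k+3}, …, x_{2k+1}⟩`), so that they apply verbatim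
to every coordinate ring and every `k`. What is NOT formalised here: flatness of `V(I^{(t)})` at `t = 0`
(equality of Hilbert functions), irreducibility of `Y_t` for general `t`, and the cycle-class computation
`[Y_0]_prim = [Π₁]_prim − [Π₂]_prim` — these remain the cited content of Prop. 6.1; Cor. 6.2
("`NL([Π₁],[Π₂])` is a subscheme of `NL([Π₁]−[Π₂])` of positive codimension", `d = 4`, `c = 2`, `k ≥ 1`) is
printed without proof and is not restated.

The last section instantiates the normal form at the Fermat quartic: over any commutative ring containing `ζ`
with `ζ⁴ = −1` (a primitive 8th root of unity in characteristic `≠ 2`),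
`x⁴ + y⁴ = (x − ζy)(x − ζ³y)·(x − ζ⁵y)(x − ζ⁷y)`, so that for two planes of the Fermat quartic fourfold
meeting in a point (sharing the form `x₀ − ζx₁`) Kloosterman's quadrics are `Q₀₂ = (x₂ − ζ⁵x₃)(x₂ − ζ⁷x₃)`,
`Q₁₃ = (x₄ − ζ⁵x₅)(x₄ − ζ⁷x₅)`, `Q₀₃ = Q₁₂ = 0` [folklore factorisation; the instance is the one used by the
Hodge-locus census of Movasati's five-tuple `(4,4,0 | 11,12)`, arXiv:1602.06607 §6].
-/

namespace Literature.AlgebraicGeometry.Kloosterman2025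

section Identities

variable {R : Type*} [CommRing R]

/-- Kloosterman's normal form of a quartic containing the two `k`-planes `Π₁ = V(x₀,x₁,…)`, `Π₂ = V(x₂,x₃,…)`
WITHOUT its linear part `Σ_{i≥k+3} xᵢPᵢ`: `f₀' = x₀x₂Q₀₂ + x₁x₂Q₁₂ + x₀x₃Q₀₃ + x₁x₃Q₁₃`.
[cite: Kloosterman2025, Prop. 6.1 (proof)] -/
def quarticNormalForm (x₀ x₁ x₂ x₃ Q₀₂ Q₁₂ Q₀₃ Q₁₃ : R) : R :=
  x₀ * x₂ * Q₀₂ + x₁ * x₂ * Q₁₂ + x₀ * x₃ * Q₀₃ + x₁ * x₃ * Q₁₃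

/-- The deformation direction `G = Q₁₃Q₀₂ − Q₁₂Q₀₃` of Kloosterman's family `f_t = f₀ + t·G`.
[cite: Kloosterman2025, Prop. 6.1 (proof)] -/
def deformationDirection (Q₀₂ Q₁₂ Q₀₃ Q₁₃ : R) : R := Q₁₃ * Q₀₂ - Q₁₂ * Q₀₃

/-- Unfolding lemma for `quarticNormalForm`. [cite: Kloosterman2025, Prop. 6.1 (proof)] -/
theorem quarticNormalForm_def (x₀ x₁ x₂ x₃ Q₀₂ Q₁₂ Q₀₃ Q₁₃ : R) :
    quarticNormalForm x₀ x₁ x₂ x₃ Q₀₂ Q₁₂ Q₀₃ Q₁₃ =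
      x₀ * x₂ * Q₀₂ + x₁ * x₂ * Q₁₂ + x₀ * x₃ * Q₀₃ + x₁ * x₃ * Q₁₃ := rfl

/-- Unfolding lemma for `deformationDirection`. [cite: Kloosterman2025, Prop. 6.1 (proof)] -/
theorem deformationDirection_def (Q₀₂ Q₁₂ Q₀₃ Q₁₃ : R) :
    deformationDirection Q₀₂ Q₁₂ Q₀₃ Q₁₃ = Q₁₃ * Q₀₂ - Q₁₂ * Q₀₃ := rfl

/-- (6.1.a), denominator-free form, valid in every commutative ring:
`t·f_t = (x₀x₂ + tQ₁₃)(tQ₀₂ + x₁x₃) + (x₁x₂ − tQ₀₃)(tQ₁₂ − x₀x₃)` where `f_t = f₀' + t(Q₁₃Q₀₂ − Q₁₂Q₀₃)`.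
[cite: Kloosterman2025, Prop. 6.1 (proof, displayed factorisation of f_t)] -/
theorem mul_deformedQuartic_eq (x₀ x₁ x₂ x₃ Q₀₂ Q₁₂ Q₀₃ Q₁₃ t : R) :
    t * (quarticNormalForm x₀ x₁ x₂ x₃ Q₀₂ Q₁₂ Q₀₃ Q₁₃ + t * deformationDirection Q₀₂ Q₁₂ Q₀₃ Q₁₃) =
      (x₀ * x₂ + t * Q₁₃) * (t * Q₀₂ + x₁ * x₃) + (x₁ * x₂ - t * Q₀₃) * (t * Q₁₂ - x₀ * x₃) := by
  unfold quarticNormalForm deformationDirection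
  ring

/-- (6.1.a) as printed, for `t` invertible (`u·t = 1` plays the role of `1/t`):
`f_t = (x₀x₂ + tQ₁₃)·(u(tQ₀₂ + x₁x₃)) + (x₁x₂ − tQ₀₃)·(u(tQ₁₂ − x₀x₃))`, i.e.
`f_t = (x₀x₂ + tQ₁₃)(Q₀₂ + x₁x₃/t) + (x₁x₂ − tQ₀₃)(Q₁₂ − x₀x₃/t)`.
[cite: Kloosterman2025, Prop. 6.1 (proof)] -/
theorem deformedQuartic_eq_of_mul_eq_one (x₀ x₁ x₂ x₃ Q₀₂ Q₁₂ Q₀₃ Q₁₃ t u : R) (hu : u * t = 1) :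
    quarticNormalForm x₀ x₁ x₂ x₃ Q₀₂ Q₁₂ Q₀₃ Q₁₃ + t * deformationDirection Q₀₂ Q₁₂ Q₀₃ Q₁₃ =
      (x₀ * x₂ + t * Q₁₃) * (u * (t * Q₀₂ + x₁ * x₃)) +
        (x₁ * x₂ - t * Q₀₃) * (u * (t * Q₁₂ - x₀ * x₃)) := by
  unfold quarticNormalForm deformationDirection
  linear_combination
    (-(x₀ * x₂ * Q₀₂ + x₁ * x₂ * Q₁₂ + x₀ * x₃ * Q₀₃ + x₁ * x₃ * Q₁₃) -
        t * (Q₁₃ * Q₀₂ - Q₁₂ * Q₀₃)) * hu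

/-- Kloosterman's complete-intersection ideal WITHOUT its linear generators:
`⟨x₀x₂ + tQ₁₃, x₁x₂ − tQ₀₃⟩` (the two quadrics of `I^{(t)}`). [cite: Kloosterman2025, Prop. 6.1 (proof)] -/
def ciQuadricsIdeal (x₀ x₁ x₂ Q₀₃ Q₁₃ t : R) : Ideal R :=
  Ideal.span {x₀ * x₂ + t * Q₁₃, x₁ * x₂ - t * Q₀₃}

/-- Unfolding lemma for `ciQuadricsIdeal`. [cite: Kloosterman2025, Prop. 6.1 (proof)] -/
theorem ciQuadricsIdeal_def (x₀ x₁ x₂ Q₀₃ Q₁₃ t : R) :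
    ciQuadricsIdeal x₀ x₁ x₂ Q₀₃ Q₁₃ t = Ideal.span {x₀ * x₂ + t * Q₁₃, x₁ * x₂ - t * Q₀₃} := rfl

/-- (6.1.a) ⇒ `f_t ∈ I^{(t)}`: for `t` invertible, the deformed quartic
`f₀' + h + t(Q₁₃Q₀₂ − Q₁₂Q₀₃)` — `h ∈ J` standing for the linear part `Σ_{i≥k+3} xᵢPᵢ ∈ J = ⟨x_{k+3},…,x_{2k+1}⟩` —
lies in `⟨x₀x₂ + tQ₁₃, x₁x₂ − tQ₀₃⟩ + J`; "in particular, for `t ≠ 0` we have that `X_t` contains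
`Y_t := V(I^{(t)})`". [cite: Kloosterman2025, Prop. 6.1 (proof)] -/
theorem deformedQuartic_mem_ciIdeal (x₀ x₁ x₂ x₃ Q₀₂ Q₁₂ Q₀₃ Q₁₃ t u h : R) (J : Ideal R)
    (hu : u * t = 1) (hh : h ∈ J) :
    quarticNormalForm x₀ x₁ x₂ x₃ Q₀₂ Q₁₂ Q₀₃ Q₁₃ + h + t * deformationDirection Q₀₂ Q₁₂ Q₀₃ Q₁₃ ∈
      ciQuadricsIdeal x₀ x₁ x₂ Q₀₃ Q₁₃ t ⊔ J := by
  have hq : quarticNormalForm x₀ x₁ x₂ x₃ Q₀₂ Q₁₂ Q₀₃ Q₁₃ + t * deformationDirection Q₀₂ Q₁₂ Q₀₃ Q₁₃ ∈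
      ciQuadricsIdeal x₀ x₁ x₂ Q₀₃ Q₁₃ t := by
    rw [ciQuadricsIdeal, Ideal.mem_span_pair]
    exact ⟨u * (t * Q₀₂ + x₁ * x₃), u * (t * Q₁₂ - x₀ * x₃), by
      rw [deformedQuartic_eq_of_mul_eq_one x₀ x₁ x₂ x₃ Q₀₂ Q₁₂ Q₀₃ Q₁₃ t u hu]; ring⟩
  have : quarticNormalForm x₀ x₁ x₂ x₃ Q₀₂ Q₁₂ Q₀₃ Q₁₃ + h + t * deformationDirection Q₀₂ Q₁₂ Q₀₃ Q₁₃ =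
      (quarticNormalForm x₀ x₁ x₂ x₃ Q₀₂ Q₁₂ Q₀₃ Q₁₃ + t * deformationDirection Q₀₂ Q₁₂ Q₀₃ Q₁₃) + h := by
    ring
  rw [this]
  exact Submodule.add_mem_sup hq hh

/-- (6.1.b): for `t` invertible, `x₁Q₁₃ + x₀Q₀₃ = u·(x₁(x₀x₂ + tQ₁₃) − x₀(x₁x₂ − tQ₀₃))` lies in
`⟨x₀x₂ + tQ₁₃, x₁x₂ − tQ₀₃⟩` ("this ideal contains … `x₁Q₁₃ + x₀Q₀₃`"; its specialisation is the third generator of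
the flat limit `I^{(0)} = ⟨x₀x₂, x₁x₂, x₁Q₁₃ + x₀Q₀₃, …⟩`). [cite: Kloosterman2025, Prop. 6.1 (proof)] -/
theorem limitGenerator_mem_ciIdeal (x₀ x₁ x₂ Q₀₃ Q₁₃ t u : R) (hu : u * t = 1) :
    x₁ * Q₁₃ + x₀ * Q₀₃ ∈ ciQuadricsIdeal x₀ x₁ x₂ Q₀₃ Q₁₃ t := by
  rw [ciQuadricsIdeal, Ideal.mem_span_pair]
  exact ⟨u * x₁, -(u * x₀), by linear_combination (x₁ * Q₁₃ + x₀ * Q₀₃) * hu⟩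

/-- The set-theoretic decomposition of the flat limit rests on `x₀x₂, x₁x₂ ∈ ⟨x₂⟩ ∩ ⟨x₀, x₁⟩`; recorded as the
ideal inclusion `⟨x₀x₂, x₁x₂, x₁Q₁₃ + x₀Q₀₃⟩ ≤ ⟨x₂, x₁Q₁₃ + x₀Q₀₃⟩` (the component `V(x₂, x₁Q₁₃ + x₀Q₀₃)` of
`V(I^{(0)})`, of class `h^k − [Π₂]`). [cite: Kloosterman2025, Prop. 6.1 (proof, last display)] -/
theorem limitIdeal_le_residualComponent (x₀ x₁ x₂ Q₀₃ Q₁₃ : R) :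
    Ideal.span {x₀ * x₂, x₁ * x₂, x₁ * Q₁₃ + x₀ * Q₀₃} ≤ Ideal.span {x₂, x₁ * Q₁₃ + x₀ * Q₀₃} := by
  apply Ideal.span_le.2
  intro y hy
  simp only [Set.mem_insert_iff, Set.mem_singleton_iff] at hy
  rcases hy with rfl | rfl | rfl
  · exact Ideal.mul_mem_left _ x₀ (Ideal.subset_span (by simp))
  · exact Ideal.mul_mem_left _ x₁ (Ideal.subset_span (by simp))
  · exact Ideal.subset_span (by simp)

/-- … and `⟨x₀x₂, x₁x₂, x₁Q₁₃ + x₀Q₀₃⟩ ≤ ⟨x₀, x₁⟩` (the component `Π₁ = V(x₀, x₁, …)` of `V(I^{(0)})`).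
[cite: Kloosterman2025, Prop. 6.1 (proof, last display)] -/
theorem limitIdeal_le_planeComponent (x₀ x₁ x₂ Q₀₃ Q₁₃ : R) :
    Ideal.span {x₀ * x₂, x₁ * x₂, x₁ * Q₁₃ + x₀ * Q₀₃} ≤ Ideal.span {x₀, x₁} := by
  apply Ideal.span_le.2
  intro y hy
  simp only [Set.mem_insert_iff, Set.mem_singleton_iff] at hy
  have h0 : x₀ ∈ Ideal.span ({x₀, x₁} : Set R) := Ideal.subset_span (by simp)
  have h1 : x₁ ∈ Ideal.span ({x₀, x₁} : Set R) := Ideal.subset_span (by simp)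
  rcases hy with rfl | rfl | rfl
  · exact Ideal.mul_mem_right _ _ h0
  · exact Ideal.mul_mem_right _ _ h1
  · exact Ideal.add_mem _ (Ideal.mul_mem_right _ _ h1) (Ideal.mul_mem_right _ _ h0)

end Identities

section FermatInstance

variable {R : Type*} [CommRing R]

/-- Factorisation of the binary Fermat quartic over a ring containing `ζ` with `ζ⁴ = −1` (e.g. `ζ = ζ₈ ∈ ℂ`):
`x⁴ + y⁴ = ((x − ζy)(x − ζ³y))·((x − ζ⁵y)(x − ζ⁷y))`, grouped as (product of two of the four linear factors) ×
(Kloosterman quadric `Q`). [folklore] -/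
theorem fermatQuartic_factor (ζ x y : R) (hζ : ζ ^ 4 = -1) :
    x ^ 4 + y ^ 4 = ((x - ζ * y) * (x - ζ ^ 3 * y)) * ((x - ζ ^ 5 * y) * (x - ζ ^ 7 * y)) := by
  have h5 : ζ ^ 5 = -ζ := by linear_combination ζ * hζ
  have h7 : ζ ^ 7 = -ζ ^ 3 := by linear_combination ζ ^ 3 * hζ
  rw [h5, h7]
  linear_combination (ζ ^ 2 * x ^ 2 * y ^ 2 - ζ ^ 4 * y ^ 4 + y ^ 4) * hζ

/-- The Fermat quartic fourfold `x₀⁴ + ⋯ + x₅⁴` is in Kloosterman's normal form with respect to the two planes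
`P = V(x₀ − ζx₁, x₂ − ζx₃, x₄ − ζx₅)`, `P̌ = V(x₀ − ζx₁, x₂ − ζ³x₃, x₄ − ζ³x₅)` (meeting in one point; shared form
`y₀ = x₀ − ζx₁` in the role of `x_{k+3}`, `k = 2`): with `y₂ = x₂ − ζx₃`, `y₄ = x₄ − ζx₅` (cutting `P`) and
`y₂' = x₂ − ζ³x₃`, `y₄' = x₄ − ζ³x₅` (cutting `P̌`) in the roles of Kloosterman's `x₀, x₁, x₂, x₃`,
`F = y₂y₂'·Q₀₂ + y₄y₄'·Q₁₃ + y₀·P₀` with `Q₀₂ = (x₂ − ζ⁵x₃)(x₂ − ζ⁷x₃)`, `Q₁₃ = (x₄ − ζ⁵x₅)(x₄ − ζ⁷x₅)`,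
`Q₀₃ = Q₁₂ = 0`, `P₀ = (x₀ − ζ³x₁)(x₀ − ζ⁵x₁)(x₀ − ζ⁷x₁)`; hence the deformation direction is
`G = Q₁₃Q₀₂`. [folklore] (instance of [cite: Kloosterman2025, Prop. 6.1 (proof)] used for Movasati's five-tuple
`(4,4,0 | 11,12)`, arXiv:1602.06607 §6) -/
theorem fermatQuarticFourfold_normalForm (ζ x₀ x₁ x₂ x₃ x₄ x₅ : R) (hζ : ζ ^ 4 = -1) :
    x₀ ^ 4 + x₁ ^ 4 + x₂ ^ 4 + x₃ ^ 4 + x₄ ^ 4 + x₅ ^ 4 =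
      quarticNormalForm (x₂ - ζ * x₃) (x₄ - ζ * x₅) (x₂ - ζ ^ 3 * x₃) (x₄ - ζ ^ 3 * x₅)
          ((x₂ - ζ ^ 5 * x₃) * (x₂ - ζ ^ 7 * x₃)) 0 0 ((x₄ - ζ ^ 5 * x₅) * (x₄ - ζ ^ 7 * x₅)) +
        (x₀ - ζ * x₁) * ((x₀ - ζ ^ 3 * x₁) * (x₀ - ζ ^ 5 * x₁) * (x₀ - ζ ^ 7 * x₁)) := by
  have e₀ := fermatQuartic_factor ζ x₀ x₁ hζ
  have e₂ := fermatQuartic_factor ζ x₂ x₃ hζ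
  have e₄ := fermatQuartic_factor ζ x₄ x₅ hζ
  unfold quarticNormalForm
  linear_combination e₀ + e₂ + e₄

end FermatInstance

end Literature.AlgebraicGeometry.Kloosterman2025
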